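import Mathlib

/-!
# `XMapKernel` (stmt-KontsevichZagierPeriods-10663), negative side: the real locus `{x³ + ax + b > 0}` of a nonsingular cubic

Real-analysis input for Part B of finding F8 (cdisprove work file `Cruxes/XMapKernel/Disproof.lean`
§6): for real `a, b` with `4a³ + 27b² ≠ 0` the open set `{t | t³ + at + b > 0}` is either a ray
`(e, ∞)` (one real root) or `(e₃, e₂) ∪ (e₁, ∞)` with `e₃ < e₂ < e₁` (three real roots)
(`cubicLocus_cases`). Elementary: intermediate value theorem for the sign at `±∞`, the factorisation
`t³ + at + b = (t − u)(t − v)(t + u + v)` through two distinct roots `u ≠ v` (the `t²`-coefficient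
vanishes), and the discriminant identity excluding a double root. No elliptic-curve theory.

Sources: J. H. Silverman, *The Arithmetic of Elliptic Curves* (2009), III.1 (discriminant of
`y² = x³ + ax + b`); folklore real analysis. -/

noncomputable section

namespace Summit.KontsevichZagierPeriods.XMapKernel.Negative

open Set

/-- The depressed real cubic `P(t) = t³ + a t + b`. [folklore] -/
def cubicFun (a b : ℝ) (t : ℝ) : ℝ := t ^ 3 + a * t + b

/-- `P` is continuous. [folklore] -/
theorem continuous_cubicFun (a b : ℝ) : Continuous (cubicFun a b) := by
  unfold cubicFun
  fun_prop

/-- A convenient radius: `R = 2 + |a| + |b|`. [folklore] -/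
def cubicRadius (a b : ℝ) : ℝ := 2 + |a| + |b|

/-- `2 ≤ R`. [folklore] -/
theorem two_le_cubicRadius (a b : ℝ) : 2 ≤ cubicRadius a b := by
  unfold cubicRadius
  have := abs_nonneg a
  have := abs_nonneg b
  linarith

/-- `P > 0` on `[R, ∞)`. [folklore] -/
theorem cubicFun_pos_of_ge (a b : ℝ) {t : ℝ} (ht : cubicRadius a b ≤ t) : 0 < cubicFun a b t := by
  unfold cubicRadius at ht
  unfold cubicFun
  have ha := abs_nonneg a
  have hb := abs_nonneg b
  have ht2 : 2 ≤ t := by linarith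
  have hat : -(|a| * t) ≤ a * t := by
    have := neg_abs_le a
    nlinarith
  have hbb : -|b| ≤ b := neg_abs_le b
  -- t³ ≥ t·t·2 and |a| t + |b| ≤ (t - 2) t + t
  have h1 : |a| ≤ t - 2 := by linarith
  have h2 : |b| ≤ t := by linarith
  nlinarith [mul_le_mul_of_nonneg_right h1 (by linarith : (0 : ℝ) ≤ t), sq_nonneg t,
    mul_pos (by linarith : (0 : ℝ) < t) (by linarith : (0 : ℝ) < t)]

/-- `P(−s) = −(s³ + a s − b)`: the reflected cubic. [folklore] -/
theorem cubicFun_neg_arg (a b s : ℝ) : cubicFun a b (-s) = -cubicFun a (-b) s := by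
  unfold cubicFun
  ring

/-- The radius is symmetric in the sign of `b`. [folklore] -/
theorem cubicRadius_neg (a b : ℝ) : cubicRadius a (-b) = cubicRadius a b := by
  unfold cubicRadius
  rw [abs_neg]

/-- `P < 0` on `(−∞, −R]`. [folklore] -/
theorem cubicFun_neg_of_le (a b : ℝ) {t : ℝ} (ht : t ≤ -cubicRadius a b) : cubicFun a b t < 0 := by
  have h : cubicRadius a (-b) ≤ -t := by rw [cubicRadius_neg]; linarith
  have hpos := cubicFun_pos_of_ge a (-b) h
  have := cubicFun_neg_arg a b (-t)
  rw [neg_neg] at this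
  linarith

/-- **A real cubic has a real root.** [folklore] -/
theorem exists_cubicFun_eq_zero (a b : ℝ) : ∃ e, cubicFun a b e = 0 := by
  have hR := two_le_cubicRadius a b
  have hlo := cubicFun_neg_of_le a b (le_refl (-cubicRadius a b))
  have hhi := cubicFun_pos_of_ge a b (le_refl (cubicRadius a b))
  have hIVT := intermediate_value_Icc (show -cubicRadius a b ≤ cubicRadius a b by linarith)
    (continuous_cubicFun a b).continuousOn
  obtain ⟨e, -, he⟩ := hIVT ⟨hlo.le, hhi.le⟩
  exact ⟨e, he⟩

/-- No root in `(t, ∞)` and `t` not a root with `P t ≤ 0` is impossible: `P` is eventually positive.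
Contrapositive packaging: if `P` has no root `≥ t` then `P t > 0`. [folklore] -/
theorem cubicFun_pos_of_no_root_ge (a b : ℝ) {t : ℝ} (h : ∀ s, t ≤ s → cubicFun a b s ≠ 0) :
    0 < cubicFun a b t := by
  by_contra hle
  push Not at hle
  set R := max t (cubicRadius a b) with hR
  have htR : t ≤ R := le_max_left _ _
  have hRpos : 0 < cubicFun a b R := cubicFun_pos_of_ge a b (le_max_right _ _)
  have hIVT := intermediate_value_Icc htR (continuous_cubicFun a b).continuousOn
  obtain ⟨s, hs, hs0⟩ := hIVT ⟨hle, hRpos.le⟩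
  exact h s hs.1 hs0

/-- Symmetrically: if `P` has no root `≤ t` then `P t < 0`. [folklore] -/
theorem cubicFun_neg_of_no_root_le (a b : ℝ) {t : ℝ} (h : ∀ s, s ≤ t → cubicFun a b s ≠ 0) :
    cubicFun a b t < 0 := by
  by_contra hge
  push Not at hge
  set R := min t (-cubicRadius a b) with hR
  have hRt : R ≤ t := min_le_left _ _
  have hRneg : cubicFun a b R < 0 := cubicFun_neg_of_le a b (min_le_right _ _)
  have hIVT := intermediate_value_Icc hRt (continuous_cubicFun a b).continuousOn
  obtain ⟨s, hs, hs0⟩ := hIVT ⟨hRneg.le, hge⟩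
  exact h s hs.2 hs0

/-! ### One real root: the locus is a ray -/

/-- **One real root.** If `e` is the only real root of `P`, then `{P > 0} = (e, ∞)`. [folklore] -/
theorem setOf_cubicFun_pos_of_unique_root (a b : ℝ) {e : ℝ} (he : cubicFun a b e = 0)
    (huniq : ∀ t, cubicFun a b t = 0 → t = e) : {t | 0 < cubicFun a b t} = Ioi e := by
  ext t
  simp only [mem_setOf_eq, mem_Ioi]
  constructor
  · intro ht
    rcases lt_trichotomy e t with h | h | h
    · exact h
    · subst h; linarith
    · -- `t < e`: no root `≤ t`, so `P t < 0`
      have hneg := cubicFun_neg_of_no_root_le a b (t := t) fun s hs hs0 => by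
        have := huniq s hs0
        subst this
        linarith
      linarith
  · intro het
    exact cubicFun_pos_of_no_root_ge a b fun s hs hs0 => by
      have := huniq s hs0
      subst this
      linarith

/-! ### Two distinct real roots: factorisation and the third root -/

/-- Through two distinct roots `u ≠ v`, the coefficients are determined: `a = −(u² + uv + v²)`.
[folklore] -/
theorem cubic_a_eq_of_two_roots {a b u v : ℝ} (hu : cubicFun a b u = 0) (hv : cubicFun a b v = 0)
    (huv : u ≠ v) : a = -(u ^ 2 + u * v + v ^ 2) := by
  unfold cubicFun at hu hv
  have hsub : (u - v) * (u ^ 2 + u * v + v ^ 2 + a) = 0 := by linear_combination hu - hv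
  rcases mul_eq_zero.1 hsub with h | h
  · exact absurd (sub_eq_zero.1 h) huv
  · linarith

/-- … and `b = uv(u + v)`. [folklore] -/
theorem cubic_b_eq_of_two_roots {a b u v : ℝ} (hu : cubicFun a b u = 0) (hv : cubicFun a b v = 0)
    (huv : u ≠ v) : b = u * v * (u + v) := by
  have ha := cubic_a_eq_of_two_roots hu hv huv
  unfold cubicFun at hu
  rw [ha] at hu
  linear_combination hu

/-- **Factorisation through two distinct roots**: `P(t) = (t − u)(t − v)(t + u + v)` (the third root is
`−u − v` because the `t²`-coefficient of `P` vanishes). [folklore] -/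
theorem cubicFun_eq_prod_of_two_roots {a b u v : ℝ} (hu : cubicFun a b u = 0) (hv : cubicFun a b v = 0)
    (huv : u ≠ v) (t : ℝ) : cubicFun a b t = (t - u) * (t - v) * (t + u + v) := by
  have ha := cubic_a_eq_of_two_roots hu hv huv
  have hb := cubic_b_eq_of_two_roots hu hv huv
  unfold cubicFun
  rw [ha, hb]
  ring

/-- **A double root kills the discriminant**: if the third root `−u − v` coincides with `u`, then
`4a³ + 27b² = 0`. [cite: SilvermanAEC2009, III.1] -/
theorem discr_eq_zero_of_double_root_left {a b u v : ℝ} (hu : cubicFun a b u = 0) (hv : cubicFun a b v = 0)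
    (huv : u ≠ v) (h : -u - v = u) : 4 * a ^ 3 + 27 * b ^ 2 = 0 := by
  have ha := cubic_a_eq_of_two_roots hu hv huv
  have hb := cubic_b_eq_of_two_roots hu hv huv
  have hv2 : v = -2 * u := by linarith
  rw [ha, hb, hv2]
  ring

/-- … and likewise if it coincides with `v`. [cite: SilvermanAEC2009, III.1] -/
theorem discr_eq_zero_of_double_root_right {a b u v : ℝ} (hu : cubicFun a b u = 0) (hv : cubicFun a b v = 0)
    (huv : u ≠ v) (h : -u - v = v) : 4 * a ^ 3 + 27 * b ^ 2 = 0 := by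
  have ha := cubic_a_eq_of_two_roots hu hv huv
  have hb := cubic_b_eq_of_two_roots hu hv huv
  have hu2 : u = -2 * v := by linarith
  rw [ha, hb, hu2]
  ring

/-- Sorting three distinct reals under a symmetric product. [folklore] -/
theorem exists_sorted_three {u v w : ℝ} (huv : u ≠ v) (huw : u ≠ w) (hvw : v ≠ w) :
    ∃ e₃ e₂ e₁ : ℝ, e₃ < e₂ ∧ e₂ < e₁ ∧
      ∀ t : ℝ, (t - u) * (t - v) * (t - w) = (t - e₁) * (t - e₂) * (t - e₃) := by
  rcases lt_or_gt_of_ne huv with h1 | h1 <;> rcases lt_or_gt_of_ne hvw with h2 | h2 <;>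
    rcases lt_or_gt_of_ne huw with h3 | h3
  · exact ⟨u, v, w, h1, h2, fun t => by ring⟩
  · exact absurd (h1.trans h2) (lt_asymm h3)
  · exact ⟨u, w, v, h3, h2, fun t => by ring⟩
  · exact ⟨w, u, v, h3, h1, fun t => by ring⟩
  · exact ⟨v, u, w, h1, h3, fun t => by ring⟩
  · exact ⟨v, w, u, h2, h3, fun t => by ring⟩
  · exact absurd (h3.trans (h2.trans h1)) (lt_irrefl u)
  · exact ⟨w, v, u, h2, h1, fun t => by ring⟩

/-- **Three sorted real roots**: `{(t − e₁)(t − e₂)(t − e₃) > 0} = (e₃, e₂) ∪ (e₁, ∞)` for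
`e₃ < e₂ < e₁`. [folklore] -/
theorem setOf_prod_pos_of_sorted {e₁ e₂ e₃ : ℝ} (h32 : e₃ < e₂) (h21 : e₂ < e₁) :
    {t : ℝ | 0 < (t - e₁) * (t - e₂) * (t - e₃)} = Ioo e₃ e₂ ∪ Ioi e₁ := by
  ext t
  simp only [mem_setOf_eq, mem_union, mem_Ioo, mem_Ioi]
  constructor
  · intro ht
    by_cases h1 : e₁ < t
    · exact Or.inr h1
    · push Not at h1
      left
      -- `t ≤ e₁`, so `(t - e₁) ≤ 0`; positivity of the product forces `(t-e₂)(t-e₃) < 0`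
      have hq : (t - e₂) * (t - e₃) < 0 := by
        by_contra hcon
        push Not at hcon
        have : (t - e₁) * (t - e₂) * (t - e₃) ≤ 0 := by
          rw [show (t - e₁) * (t - e₂) * (t - e₃) = (t - e₁) * ((t - e₂) * (t - e₃)) by ring]
          exact mul_nonpos_of_nonpos_of_nonneg (by linarith) hcon
        linarith
      constructor
      · by_contra h3
        push Not at h3
        have : 0 ≤ (t - e₂) * (t - e₃) := mul_nonneg_of_nonpos_of_nonpos (by linarith) (by linarith)
        linarith
      · by_contra h2
        push Not at h2
        have : 0 ≤ (t - e₂) * (t - e₃) := mul_nonneg (by linarith) (by linarith)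
        linarith
  · rintro (⟨h3, h2⟩ | h1)
    · have ha : 0 < e₁ - t := by linarith
      have hb : 0 < e₂ - t := by linarith
      have hc : 0 < t - e₃ := by linarith
      rw [show (t - e₁) * (t - e₂) * (t - e₃) = (e₁ - t) * (e₂ - t) * (t - e₃) by ring]
      positivity
    · have ha : 0 < t - e₁ := by linarith
      have hb : 0 < t - e₂ := by linarith
      have hc : 0 < t - e₃ := by linarith
      positivity

/-- **The real locus of a nonsingular depressed cubic** is a ray or an interval plus a ray:
for `4a³ + 27b² ≠ 0`, `{t | t³ + at + b > 0}` is `(e, ∞)` or `(e₃, e₂) ∪ (e₁, ∞)` with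
`e₃ < e₂ < e₁`. [cite: SilvermanAEC2009, III.1] -/
theorem cubicLocus_cases (a b : ℝ) (hδ : 4 * a ^ 3 + 27 * b ^ 2 ≠ 0) :
    (∃ e : ℝ, {t | 0 < cubicFun a b t} = Ioi e) ∨
      ∃ e₃ e₂ e₁ : ℝ, e₃ < e₂ ∧ e₂ < e₁ ∧ {t | 0 < cubicFun a b t} = Ioo e₃ e₂ ∪ Ioi e₁ := by
  obtain ⟨u, hu⟩ := exists_cubicFun_eq_zero a b
  by_cases huniq : ∀ t, cubicFun a b t = 0 → t = u
  · exact Or.inl ⟨u, setOf_cubicFun_pos_of_unique_root a b hu huniq⟩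
  · push Not at huniq
    obtain ⟨v, hv, hvu⟩ := huniq
    have huv : u ≠ v := fun h => hvu h.symm
    have hfac := cubicFun_eq_prod_of_two_roots hu hv huv
    -- the third root `w = -u - v` is distinct from `u` and `v` (no double root)
    set w := -u - v with hw
    have hwu : u ≠ w := fun h => hδ (discr_eq_zero_of_double_root_left hu hv huv (by rw [← hw]; exact h.symm))
    have hwv : v ≠ w := fun h => hδ (discr_eq_zero_of_double_root_right hu hv huv (by rw [← hw]; exact h.symm))
    obtain ⟨e₃, e₂, e₁, h32, h21, hprod⟩ := exists_sorted_three huv hwu hwv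
    refine Or.inr ⟨e₃, e₂, e₁, h32, h21, ?_⟩
    have hfac' : ∀ t, cubicFun a b t = (t - e₁) * (t - e₂) * (t - e₃) := fun t => by
      rw [hfac t, ← hprod t, hw]
      ring
    have : {t | 0 < cubicFun a b t} = {t : ℝ | 0 < (t - e₁) * (t - e₂) * (t - e₃)} := by
      ext t
      simp only [mem_setOf_eq, hfac' t]
    rw [this]
    exact setOf_prod_pos_of_sorted h32 h21

/-- Integer-coefficient form used by the crux: for `A, B : ℤ` with `4A³ + 27B² ≠ 0`, the locus
`{t | t³ + A t + B > 0}` is a ray or an interval plus a ray. [cite: SilvermanAEC2009, III.1] -/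
theorem cubicLocus_cases_int (A B : ℤ) (hΔ : 4 * A ^ 3 + 27 * B ^ 2 ≠ 0) :
    (∃ e : ℝ, {t : ℝ | 0 < t ^ 3 + (A : ℝ) * t + (B : ℝ)} = Ioi e) ∨
      ∃ e₃ e₂ e₁ : ℝ, e₃ < e₂ ∧ e₂ < e₁ ∧
        {t : ℝ | 0 < t ^ 3 + (A : ℝ) * t + (B : ℝ)} = Ioo e₃ e₂ ∪ Ioi e₁ := by
  have hδ : 4 * (A : ℝ) ^ 3 + 27 * (B : ℝ) ^ 2 ≠ 0 := by exact_mod_cast hΔ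
  exact cubicLocus_cases (A : ℝ) (B : ℝ) hδ

end Summit.KontsevichZagierPeriods.XMapKernel.Negative
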